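import Summits.ABC.IUTFork.Repair.RLana91CellGrain
import Summits.ABC.IUTFork.Repair.RLana91GenuineBed
import HarnessLib

/-!
# REPAIR-CATALOGUE row R-LANA (RC-130) — the per-cell IDENTIFICATION family `RLana91CellGrain.CellVolId` DECIDED AT THE GENUINE SHARP BED:
# it holds at a cell `(j, v_ℚ)` iff `j = 1` or the q-pilot's local log-volume there vanishes (D-0123 (C); KEY RLANA, seat abc-iut-rcat-tst-9)

PROOF-ONLY sequel (D-0012; no definition, no `Prop` fact) of `RLana91CellGrain.lean` (p511050: the two per-cell reading predicates of LANA's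
(9-1)) and `RLana91GenuineBed.lean` (p511969: (9-1) as typed, `Repair.CandLana1.H`, is FALSE at abc-iut-c312-7's sharp setting with realising
ideles). TAKES NO SIDE on [IUTchIII] Cor. 3.12 / [IUTchIV] Thm. 1.10, on the LANA authors, or on any author; nothing here asserts abc proved or
refuted; decided-as-typed ≠ decided-in-print.

WHAT IS PROVED, at `Thm311.Real.settingPrVolSharp X …` (ANY pilot data `X`) with Θ-ideles `t` realising `P_Θ` and q-ideles `tq` realising
`P_q` (c312-7's binders `ht`, `htq`, as in p426498 / p430714 / p511969):
* `logvol_eq_logvol_thetaRegion3_of_mem_possibleImages_settingPrVolSharp` — every possible image in a packet has the log-volume of the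
  (Ind3)-enlarged region itself (abc-iut-s2-p9 `logvol_eq_of_mem_possibleImages_settingPrVolSharp`, applied twice);
* **`cellVolId_settingPrVolSharp_iff`** — `CellVolId P i v_ℚ ↔ (i = 0 ∨ P.qLocal (i+1) v_ℚ = 0)`: by abc-iut-C-cert-1's HONEST `j²`-SCALING
  theorem `PinnedHonestReal.scaled_settingPrVolSharp` (`ln μ(𝒰^Θ_{j,v_ℚ}) = j²·ln μ(q_{j,v_ℚ})`, Dupuy–Hilado Thm. 3.10.1 `P_{Θ,j} = j²·P_q`) the
  identification `ln μ(q) = ln μ(U)` reads `(j² − 1)·ln μ(q_{j,v_ℚ}) = 0`; so on the genuine bed the per-cell identification family is INHABITED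
  exactly at the label `j = 1` (and at the cells of q-volume `0`: the archimedean cells and the primes off the support) and REFUTED at every cell
  `(j ≥ 2, v_ℚ = p)` carrying q-volume — decided by theorem, cell by cell, no table needed;
* `not_forall_cellVolId_settingPrVolSharp` — identification at every cell fails there (it would give (9-1), `RLana91CellGrain.H_of_forall_cellVolId`,
  refuted by `RLana91GenuineBed.not_H_settingPrVolSharp`).
HONEST SCOPE: statements about OUR typed objects (sharp boxes absorb (Ind3); (Ind1)/(Ind2) volume-preserving, Dupuy–Hilado's reading); the
realising binders are inhabited over `K` (`exists_ideles_settingPrVolSharp`), not at F-level pilot data of an initial Θ-datum (`SideVacuity`).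
[cite: LANA2026Report, §9.2 (9-1) p. 46; §9.3 p. 46] [cite: DupuyHilado2025, §3.3, §3.4, Thm. 3.10.1] [cite: Mochizuki2012, IUTchIII Cor. 3.12 proof
Step (x) p. 181] [claim: Mochizuki2012, status: disputed] for every quoted construction.
-/

noncomputable section

open Set Function NumberField IsDedekindDomain

namespace Summit.ABC.IUTFork.Repair.RLana91GenuineBed

open Thm311 Thm311.Real Cor312 Cor312Vol Cor312Vol.PinnedHonestReal Literature.IUT.LogThetaLattice Literature.IUT.LogVolume
  Literature.IUT.HodgeTheaters Literature.NumberTheory.NumberFields Repair.RLana91CellGrain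

variable {F : Type} [Field F] [NumberField F] (X : PilotData F) {logv : PadicLogs F} (hlog : LogvAnalytic logv)
  (M : Type) [Field M] [NumberField M]
  (archPk : ∀ (j : (thetaIndex X).Label) (vQ : (thetaIndex X).VQ), Set ((logShellsDH X logv).Packet j vQ))
  (archSub : ∀ (j : (thetaIndex X).Label) (v : (thetaIndex X).V),
    Set ((logShellsDH X logv).Packet j ((thetaIndex X).over v)))
  (Ψ : ℤ → ∀ v : (thetaIndex X).V, v ∈ (thetaIndex X).Vbad → Set ((logShellsDH X logv).StarPacket v))
  (act : ℤ → ∀ v : (thetaIndex X).V, v ∈ (thetaIndex X).Vbad →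
    (logShellsDH X logv).StarPacket v → Module.End ℚ ((logShellsDH X logv).StarPacket v))
  (Mmod : ℤ → ∀ j : (thetaIndex X).LabelStar, Set ((logShellsDH X logv).GlobalPacket j.1))
  (region : ℤ → ∀ j : (thetaIndex X).LabelStar, FinDivisor M → ∀ vQ : (thetaIndex X).VQ,
    Set ((logShellsDH X logv).Packet j.1 vQ))
  (n : ℤ) {HT : Type} {LogLink : HT → HT → Type} {IsFull : ∀ {s t : HT}, LogLink s t → Prop}
  (lat : LGPGaussianLogThetaLattice LogLink IsFull)
  {Frd : Type} {IsoF : Frd → Frd → Type} {Ob : Frd → Type} {realify : Frd → Frd} {Strip : Type}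
  {IsoS : Strip → Strip → Type} {Mv : ∀ v : (thetaIndex X).V, v ∈ (thetaIndex X).Vbad → Type}
  [∀ v h, Monoid (Mv v h)]
  (sig : GlobalLGPFrobenioidSignature (thetaIndex X).lstar (thetaIndex X).V (· ∈ (thetaIndex X).Vbad)
    Frd IsoF Ob realify Strip IsoS Mv)
  (split : SplittingMonoids Mv) {ObΔ : Type} {N : ∀ v : (thetaIndex X).V, v ∈ (thetaIndex X).Vbad → Type}
  [∀ v h, Monoid (N v h)] (qData : QPilotData ObΔ N)
  (t : ∀ (pp : Nat.Primes) (_ : Fin X.lstar) (x : (thetaIndex X).Fibre (.inr pp)),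
    haveI : Fact (pp : ℕ).Prime := ⟨pp.2⟩; kOf X pp.1 x)
  (tq : ∀ (pp : Nat.Primes) (x : (thetaIndex X).Fibre (.inr pp)), haveI : Fact (pp : ℕ).Prime := ⟨pp.2⟩; kOf X pp.1 x)

/-- At the genuine sharp bed (non-zero Θ-ideles) EVERY possible image in the packet `(j, v_ℚ)` has the log-volume of the (Ind3)-enlarged
region `𝒰^Θ_{j,v_ℚ}` itself (abc-iut-s2-p9 `logvol_eq_of_mem_possibleImages_settingPrVolSharp`: both equal the volume of the sharp Kummer
image; the enlarged region is a possible image, `Cor312.Setting.thetaRegion3_mem_possibleImages`).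
[cite: Mochizuki2012, IUTchIII Cor. 3.12 proof Step (x) p. 181] -/
theorem logvol_eq_logvol_thetaRegion3_of_mem_possibleImages_settingPrVolSharp (ht0 : ∀ pp i x, t pp i x ≠ 0)
    (htq0 : ∀ pp x, tq pp x ≠ 0)
    (htq1 : ∀ (pp : Nat.Primes) (x : (thetaIndex X).Fibre (.inr pp)),
      haveI : Fact (pp : ℕ).Prime := ⟨pp.2⟩; placeOf X pp.1 x ∉ X.S → ‖tq pp x‖ = 1)
    (j : (thetaIndex X).Label) (vQ : (thetaIndex X).VQ) {U : Set ((logShellsDH X logv).Packet j vQ)}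
    (hU : U ∈ (settingPrVolSharp X hlog M archPk archSub Ψ act Mmod region n lat sig split qData tq t htq0 htq1).possibleImages j vQ) :
    ((situationPrVol X hlog M archPk archSub Ψ act Mmod region).D n).logvol j vQ U =
      ((situationPrVol X hlog M archPk archSub Ψ act Mmod region).D n).logvol j vQ
        ((settingPrVolSharp X hlog M archPk archSub Ψ act Mmod region n lat sig split qData tq t htq0 htq1).thetaRegion3 j vQ) :=
  (logvol_eq_of_mem_possibleImages_settingPrVolSharp X hlog M archPk archSub Ψ act Mmod region n lat sig split qData tq t htq0 htq1 ht0
      j vQ hU).2.trans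
    (logvol_eq_of_mem_possibleImages_settingPrVolSharp X hlog M archPk archSub Ψ act Mmod region n lat sig split qData tq t htq0 htq1 ht0
      j vQ ((settingPrVolSharp X hlog M archPk archSub Ψ act Mmod region n lat sig split qData tq t htq0 htq1).thetaRegion3_mem_possibleImages j vQ)).2.symm

/-- **The per-cell IDENTIFICATION family decided at the genuine sharp bed**: for realising Θ- and q-ideles, `CellVolId P i v_ℚ` («some possible
image at `(j = i+1, v_ℚ)` has the q-pilot's log-volume») holds IFF `j = 1` or the q-pilot's local log-volume at the cell is `0` — every possible
image has volume `ln μ(𝒰^Θ_{j,v_ℚ}) = j²·ln μ(q_{j,v_ℚ})` (abc-iut-C-cert-1 `PinnedHonestReal.scaled_settingPrVolSharp`, Dupuy–Hilado Thm. 3.10.1).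
So the family is inhabited exactly on the label-`1` cells (and the volume-`0` cells) and refuted at every `(j ≥ 2, v_ℚ)` carrying q-volume.
[cite: DupuyHilado2025, Thm. 3.10.1] [cite: LANA2026Report, §9.3 p. 46] -/
theorem cellVolId_settingPrVolSharp_iff (ht0 : ∀ pp i x, t pp i x ≠ 0)
    (ht : ∀ (pp : Nat.Primes) (i : Fin X.lstar) (x : (thetaIndex X).Fibre (.inr pp)),
      haveI : Fact (pp : ℕ).Prime := ⟨pp.2⟩
      Real.log ‖t pp i x‖ = -(X.thetaPilot i (placeOf X pp.1 x)) * logNorm F (placeOf X pp.1 x) /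
        localDegree F (placeOf X pp.1 x))
    (htq0 : ∀ pp x, tq pp x ≠ 0)
    (htq1 : ∀ (pp : Nat.Primes) (x : (thetaIndex X).Fibre (.inr pp)),
      haveI : Fact (pp : ℕ).Prime := ⟨pp.2⟩; placeOf X pp.1 x ∉ X.S → ‖tq pp x‖ = 1)
    (htq : ∀ (pp : Nat.Primes) (x : (thetaIndex X).Fibre (.inr pp)),
      haveI : Fact (pp : ℕ).Prime := ⟨pp.2⟩
      Real.log ‖tq pp x‖ = -(X.qPilot (placeOf X pp.1 x)) * logNorm F (placeOf X pp.1 x) /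
        localDegree F (placeOf X pp.1 x))
    (i : Fin (thetaIndex X).lstar) (vQ : (thetaIndex X).VQ) :
    CellVolId (settingPrVolSharp X hlog M archPk archSub Ψ act Mmod region n lat sig split qData tq t htq0 htq1) i vQ ↔
      ((i : ℕ) = 0 ∨ (settingPrVolSharp X hlog M archPk archSub Ψ act Mmod region n lat sig split qData tq t htq0 htq1).qLocal (Setting.labelSucc i) vQ = 0) := by
  have hs := scaled_settingPrVolSharp X hlog M archPk archSub Ψ act Mmod region n lat sig split qData t tq ht0 ht htq0 htq1 htq i vQ
  constructor
  · rintro ⟨U, hU, hvol⟩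
    have hvol' : (settingPrVolSharp X hlog M archPk archSub Ψ act Mmod region n lat sig split qData tq t htq0 htq1).qLocal
          (Setting.labelSucc i) vQ =
        ((situationPrVol X hlog M archPk archSub Ψ act Mmod region).D n).logvol (Setting.labelSucc i) vQ U := hvol
    rw [logvol_eq_logvol_thetaRegion3_of_mem_possibleImages_settingPrVolSharp X hlog M archPk archSub Ψ act Mmod region n lat sig split
      qData t tq ht0 htq0 htq1 _ vQ hU, hs] at hvol'
    -- hvol' : q = (i+1)² · q
    by_contra hne
    push Not at hne
    have h2 : (2 : ℝ) ≤ ((((i : ℕ) + 1 : ℕ) : ℝ)) := by exact_mod_cast (show 2 ≤ (i : ℕ) + 1 by omega)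
    have hmul : (settingPrVolSharp X hlog M archPk archSub Ψ act Mmod region n lat sig split qData tq t htq0 htq1).qLocal
        (Setting.labelSucc i) vQ * (((((i : ℕ) + 1 : ℕ) : ℝ)) ^ 2 - 1) = 0 := by
      linear_combination (-1 : ℝ) * hvol'
    rcases mul_eq_zero.1 hmul with h | h
    · exact hne.2 h
    · nlinarith
  · intro h
    refine ⟨(settingPrVolSharp X hlog M archPk archSub Ψ act Mmod region n lat sig split qData tq t htq0 htq1).thetaRegion3 _ vQ,
      (settingPrVolSharp X hlog M archPk archSub Ψ act Mmod region n lat sig split qData tq t htq0 htq1).thetaRegion3_mem_possibleImages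
        _ vQ, ?_⟩
    show _ = ((situationPrVol X hlog M archPk archSub Ψ act Mmod region).D n).logvol (Setting.labelSucc i) vQ _
    rw [hs]
    rcases h with hi | hq
    · rw [hi]
      norm_num
    · rw [hq, mul_zero]

/-- **Identification at EVERY cell fails at the genuine sharp bed** with realising ideles: a global choice of possible images with the
q-pilot's volume in every packet would have procession-normalised total `−|log(q)|`, against
`RLana91GenuineBed.processionNormalized_imageChoice_lt_negLogQ_settingPrVolSharp` (every global possible image has total `−deĝ̲_lgp(P_Θ) <
−|log(q)|`). [cite: LANA2026Report, §9.2 (9-1) p. 46] [cite: DupuyHilado2025, Thm. 3.10.1] -/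
theorem not_forall_cellVolId_settingPrVolSharp (ht0 : ∀ pp i x, t pp i x ≠ 0)
    (ht : ∀ (pp : Nat.Primes) (i : Fin X.lstar) (x : (thetaIndex X).Fibre (.inr pp)),
      haveI : Fact (pp : ℕ).Prime := ⟨pp.2⟩
      Real.log ‖t pp i x‖ = -(X.thetaPilot i (placeOf X pp.1 x)) * logNorm F (placeOf X pp.1 x) /
        localDegree F (placeOf X pp.1 x))
    (htq0 : ∀ pp x, tq pp x ≠ 0)
    (htq1 : ∀ (pp : Nat.Primes) (x : (thetaIndex X).Fibre (.inr pp)),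
      haveI : Fact (pp : ℕ).Prime := ⟨pp.2⟩; placeOf X pp.1 x ∉ X.S → ‖tq pp x‖ = 1)
    (htq : ∀ (pp : Nat.Primes) (x : (thetaIndex X).Fibre (.inr pp)),
      haveI : Fact (pp : ℕ).Prime := ⟨pp.2⟩
      Real.log ‖tq pp x‖ = -(X.qPilot (placeOf X pp.1 x)) * logNorm F (placeOf X pp.1 x) /
        localDegree F (placeOf X pp.1 x)) :
    ¬ ∀ (i : Fin (thetaIndex X).lstar) (vQ : (thetaIndex X).VQ),
        CellVolId (settingPrVolSharp X hlog M archPk archSub Ψ act Mmod region n lat sig split qData tq t htq0 htq1) i vQ :=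
  fun h => by
  choose U hU hvol using h
  have hlt := processionNormalized_imageChoice_lt_negLogQ_settingPrVolSharp X hlog M archPk archSub Ψ act Mmod region n lat sig split
    qData t tq ht0 ht htq0 htq1 htq ⟨fun c => U c.1 c.2, fun c => hU c.1 c.2⟩
  refine absurd ?_ (ne_of_lt hlt)
  show _ = processionNormalized fun i : Fin (thetaIndex X).lstar => ∑ᶠ vQ : (thetaIndex X).VQ,
    (settingPrVolSharp X hlog M archPk archSub Ψ act Mmod region n lat sig split qData tq t htq0 htq1).qLocal (Setting.labelSucc i) vQ
  congr 1
  funext i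
  exact finsum_congr fun vQ => (hvol i vQ).symm

end Summit.ABC.IUTFork.Repair.RLana91GenuineBed

end
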